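import Summits.BirchSwinnertonDyer.BirchSwinnertonDyer.Theorems.AlignedTransportAtTwoMainConjectureTransportAlignedAtTwoKilfordStratum
import Literature.NumberTheory.EllipticCurves.SupersingularAtTwoDiscriminantModEight
import Literature.NumberTheory.EllipticCurves.TwoAdicImageQuadraticTwistProofs
import Literature.NumberTheory.EllipticCurves.Zhai2016.NonvanishingQuadraticTwists
import HarnessLib

/-!
# Route `GenusKolyvaginAtTwo`, crux U₂ `MinimalTwinBSDTwo` (stmt-BirchSwinnertonDyer-22985): THE DYADIC / ORDINARY DICTIONARY AT `2`
# — for a curve with GOOD reduction at `2`, «good ORDINARY at `2`» ⟺ «the `2`-division cubic has a root in `ℚ₂`» ⟺ «the cubic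
# `2`-division field embeds in `ℚ₂`» (is DYADIC); good SUPERSINGULAR at `2` ⟹ NO `ℚ₂`-root

Seat `bsd-line-gk2-p2` g30 (PROVER seat 2/3, cell `bsd-f1-sign2`, LINE 23 «twin_swap» holder), `--supports stmt-BirchSwinnertonDyer-22985`
(helper; closes nothing).  THEOREMS ONLY (no definition, no named fact, no `sorry`); standard axioms.  **BSD is NOT proved by this file; U₂ is
NOT proved; no item is closed.**  Elementary `2`-adic algebra of the minimal Weierstrass equation.

WHY (U₂ currency).  The U₂ crux-idea card `Cruxes/MinimalTwinBSDTwo/Ideas/u2-mod2-dihedral-cm-transfer.md` (pen bsd-idea-1 g28, filed by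
this seat per director-bsd (696)(2)) works on the sub-cell {`Δ_W < 0`, `ρ̄_{W,2}` onto, `2 ∤ N_W`, `2` split in `k_W = ℚ(√Δ_W)`, cubic
`2`-division field `F` with prescribed behaviour above `2`} and predicts «hence `a₂(W)` odd».  The cell's refuter / typer seats read the
reduction type at `2` through the WALL tetrachotomy bit `2 ∣ a₂(W)` (`frobeniusTrace`), route `AlignedTransportAtTwo` reads cubic
`2`-division fields through «dyadic» = `Nonempty (F →+* ℚ_[2])` (att-p4 g34) and has the ORDINARY half of the dictionary
(`…KilfordStratum.exists_padicInt_root_of_isOrdinaryAt_two`: good ordinary ⟹ an odd-unit root of the `u`-cubic in `ℤ₂`, Hensel).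
This file supplies the SUPERSINGULAR half and the resulting two-sided dictionary, so that «ordinary at 2» and «F dyadic» are
interchangeable on the good-at-`2` locus where U₂'s card and the (★)-door live:

* §1 `not_two_dvd_b₆_of_a₁_eq_two_mul_of_not_two_dvd_Δ` — on an integral equation with `a₁` even and `Δ` odd, `b₆` is odd
  (`Δ + 27 b₆² ∈ 8ℤ`, tree `Δ_add_mul_b₆_sq_eq_eight_mul_of_a₁_eq_two_mul`).
* §2 ★ `aeval_twoDivisionUCubic_ne_zero_of_two_dvd_frobeniusTrace_two` — `W/ℚ` globally minimal, GOOD reduction at `2`, `2 ∣ a₂(W)`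
  (supersingular): the `u`-cubic `c_W = u³ + b₂u² + 8b₄u + 16b₆` (`u = 4x`) has NO root in `ℚ₂`.  Proof (Newton polygon, written with
  `2`-adic norms): `a₁` is even (tree `two_dvd_a₁_integralModelInt_of_two_dvd_frobeniusTrace_two`), so `4 ∣ b₂`, `2 ∣ b₄`, `b₆` odd;
  for a root `y`, `‖y‖³ = ‖b₂y² + 8b₄y + 16b₆‖`; if `‖y‖ ≥ 1/2` the right side is `< ‖y‖³`; otherwise `‖y‖ ≤ 1/4` (discreteness), the
  right side equals `‖16 b₆‖ = 1/16`, but `‖y‖³ ≤ 1/64`.  (Serre 1972 §1.11 in disguise: the roots have valuation `4/3`, `e = 3`.)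
* §3 THE DICTIONARY on the good-at-`2` locus: `isOrdinaryAt_two_iff_exists_padic_root` (`IsOrdinaryAt W 2 ↔ ∃ y : ℚ_[2], c_W(y) = 0`);
  with `E(ℚ)[2] = 0` and a cubic field `F ∋` a root of `c_W`: `isOrdinaryAt_two_iff_nonempty_algHom_padic`,
  `isOrdinaryAt_two_iff_nonempty_ringHom_padic` (`↔ Nonempty (F →+* ℚ_[2])`); in Zhai's dialect (`Zhai2016.IsTwoDivisionField W F`,
  the `x`-cubic) `isOrdinaryAt_two_iff_nonempty_ringHom_padic_of_isTwoDivisionField`; and the supersingular exclusion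
  `isEmpty_ringHom_padic_of_two_dvd_frobeniusTrace_two`.

References: [SilvermanAEC2009] III.1 (b-invariants), III.2.3 (2-division polynomial), V.4 + Ex. 5.7 (supersingular in char. 2 ⟺ ā₁ = 0),
VII.2; [Serre1972] §1.11 (inertia at a good supersingular prime acts through the level-2 fundamental character: e = p² − 1 = 3 at p = 2);
[NeukirchANT1999] II §8 (8.2)–(8.3) (embeddings `F → ℚ_p` ↔ roots of the minimal polynomial in `ℚ_p` ↔ primes of residue degree and
ramification index one).
-/

set_option autoImplicit false
set_option linter.dupNamespace false -- `Summit.<P>.<Sub>` repeats `BirchSwinnertonDyer` (D-0017)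

noncomputable section

open scoped Classical

open Polynomial WeierstrassCurve NumberField
open Literature.NumberTheory.EllipticCurves Literature.NumberTheory.EllipticCurves.Greenberg1999
  Literature.NumberTheory.EllipticCurves.Zhai2016
open Summit.BirchSwinnertonDyer.Rank1Residual.F1Sign2
open Summit.BirchSwinnertonDyer.BirchSwinnertonDyer.Theorems.AlignedTransportAtTwoBridge
open Summit.BirchSwinnertonDyer.BirchSwinnertonDyer.Theorems.AlignedTransportAtTwoKilfordStratum

namespace Summit.BirchSwinnertonDyer.BirchSwinnertonDyer.Theorems.GenusExact.TwinSwap.DyadicOrdinary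

/-! ## §1 Parities of the `b`-invariants of an integral equation with `a₁` even -/

/-- `a₁ = 2s ⟹ b₂ = 4(s² + a₂)` (`b₂ = a₁² + 4a₂`). [cite: SilvermanAEC2009, III.1 (definition of b₂)] -/
theorem b₂_eq_four_mul_of_a₁_eq_two_mul {R : Type*} [CommRing R] (M : WeierstrassCurve R) {s : R} (h : M.a₁ = 2 * s) :
    M.b₂ = 4 * (s ^ 2 + M.a₂) := by
  simp only [WeierstrassCurve.b₂, h]; ring

/-- `a₁ = 2s ⟹ b₄ = 2(a₄ + s a₃)` (`b₄ = 2a₄ + a₁a₃`). [cite: SilvermanAEC2009, III.1 (definition of b₄)] -/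
theorem b₄_eq_two_mul_of_a₁_eq_two_mul {R : Type*} [CommRing R] (M : WeierstrassCurve R) {s : R} (h : M.a₁ = 2 * s) :
    M.b₄ = 2 * (M.a₄ + s * M.a₃) := by
  simp only [WeierstrassCurve.b₄, h]; ring

/-- **`a₁` even and `Δ` odd ⟹ `b₆` odd** (integral equation): `Δ + 27 b₆² ∈ 8ℤ` when `a₁` is even
(`Δ_add_mul_b₆_sq_eq_eight_mul_of_a₁_eq_two_mul`), so `2 ∣ b₆` would force `2 ∣ Δ`. [cite: SilvermanAEC2009, III.1 (b-invariants and Δ)] -/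
theorem not_two_dvd_b₆_of_a₁_eq_two_mul_of_not_two_dvd_Δ (M : WeierstrassCurve ℤ) {s : ℤ} (h : M.a₁ = 2 * s)
    (hΔ : ¬ (2 : ℤ) ∣ M.Δ) : ¬ (2 : ℤ) ∣ M.b₆ := by
  rintro ⟨k, hk⟩
  apply hΔ
  have hid := Δ_add_mul_b₆_sq_eq_eight_mul_of_a₁_eq_two_mul M s h
  exact ⟨4 * (-2 * (s ^ 2 + M.a₂) ^ 2 * M.b₈ - 8 * (M.a₄ + s * M.a₃) ^ 3 +
      9 * (s ^ 2 + M.a₂) * (M.a₄ + s * M.a₃) * M.b₆) - 54 * k ^ 2, by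
    linear_combination hid - 27 * (M.b₆ + 2 * k) * hk⟩

/-! ## §2 Good SUPERSINGULAR reduction at `2` ⟹ the `u`-cubic has no root in `ℚ₂` -/

/-- An integer divisible by `2^n` has `2`-adic norm `≤ (1/2)^n`. [folklore] -/
theorem norm_intCast_padic_le_of_dvd {k : ℤ} {n : ℕ} (h : (2 : ℤ) ^ n ∣ k) : ‖(k : ℚ_[2])‖ ≤ (1 / 2 : ℝ) ^ n := by
  have h' := (Padic.norm_int_le_pow_iff_dvd (p := 2) k n).mpr (by exact_mod_cast h)
  simp only [Nat.cast_ofNat] at h'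
  rw [one_div, inv_pow, ← zpow_natCast, ← zpow_neg]
  exact h'

/-- An odd integer has `2`-adic norm `1`. [folklore] -/
theorem norm_intCast_padic_eq_one_of_not_two_dvd {k : ℤ} (h : ¬ (2 : ℤ) ∣ k) : ‖(k : ℚ_[2])‖ = 1 := by
  refine le_antisymm (Padic.norm_int_le_one k) (not_lt.mp fun hlt ↦ h ?_)
  exact_mod_cast (Padic.norm_intCast_lt_one_iff (p := 2)).mp hlt

/-- ★ **Good SUPERSINGULAR reduction at `2` ⟹ the `u`-cubic `c_W = u³ + b₂u² + 8b₄u + 16b₆` has NO root in `ℚ₂`.**  `W/ℚ` globally minimal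
with good reduction at `2` and `2 ∣ a₂(W)`.  (Newton polygon: `4 ∣ b₂`, `16 ∣ 8b₄`, `2⁴ ∥ 16b₆`, a single segment of slope `4/3` — the three
roots generate the totally ramified cubic extension of `ℚ₂`; Serre's `e = 3`.)  Written with `2`-adic norms: for a root `y`,
`‖y‖³ = ‖b₂y² + 8b₄y + 16b₆‖`; `‖y‖ ≥ 1/2` makes the right side `< ‖y‖³`; `‖y‖ ≤ 1/4` makes it `= 1/16 > ‖y‖³`.
[cite: Serre1972, §1.11 (good supersingular reduction: tame inertia acts through the fundamental character of level 2)]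
[cite: SilvermanAEC2009, V.4 and Exercise 5.7; VII.2] -/
theorem aeval_twoDivisionUCubic_ne_zero_of_two_dvd_frobeniusTrace_two (W : WeierstrassCurve ℚ) [W.IsElliptic] [W.IsGloballyMinimal]
    (hgood : W.HasGoodReductionAtPrime 2) (hss : (2 : ℤ) ∣ W.frobeniusTrace 2) (y : ℚ_[2]) :
    aeval y (twoDivisionUCubic W) ≠ 0 := by
  set M := integralModelInt W with hM
  -- parities on the minimal equation: `a₁ = 2s`, `Δ` odd, hence `4 ∣ b₂`, `2 ∣ b₄`, `b₆` odd
  obtain ⟨s, hs⟩ := two_dvd_a₁_integralModelInt_of_two_dvd_frobeniusTrace_two W hgood hss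
  have hΔ : ¬ (2 : ℤ) ∣ M.Δ := by
    exact_mod_cast not_dvd_minimalDiscriminantInt_of_hasGoodReductionAtPrime' W 2 hgood
  have hb₂ : M.b₂ = 4 * (s ^ 2 + M.a₂) := b₂_eq_four_mul_of_a₁_eq_two_mul M hs
  have hb₄ : M.b₄ = 2 * (M.a₄ + s * M.a₃) := b₄_eq_two_mul_of_a₁_eq_two_mul M hs
  have hb₆ : ¬ (2 : ℤ) ∣ M.b₆ := not_two_dvd_b₆_of_a₁_eq_two_mul_of_not_two_dvd_Δ M hs hΔ
  -- norms of the coefficients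
  have hnb₂ : ‖(M.b₂ : ℚ_[2])‖ ≤ (1 / 2 : ℝ) ^ 2 :=
    norm_intCast_padic_le_of_dvd ⟨s ^ 2 + M.a₂, by rw [hb₂]; ring⟩
  have hnb₄ : ‖((8 * M.b₄ : ℤ) : ℚ_[2])‖ ≤ (1 / 2 : ℝ) ^ 4 :=
    norm_intCast_padic_le_of_dvd ⟨M.a₄ + s * M.a₃, by rw [hb₄]; ring⟩
  have h2 : ‖(2 : ℚ_[2])‖ = 1 / 2 := by
    have h := Padic.norm_p (p := 2)
    simp only [Nat.cast_ofNat] at h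
    rw [h]; norm_num
  have hnb₆ : ‖((16 * M.b₆ : ℤ) : ℚ_[2])‖ = (1 / 2 : ℝ) ^ 4 := by
    push_cast
    rw [norm_mul, norm_intCast_padic_eq_one_of_not_two_dvd hb₆, mul_one,
      show (16 : ℚ_[2]) = 2 ^ 4 by norm_num, norm_pow, h2]
  -- the root relation with the integer coefficients of the minimal model
  intro hy
  have h := hy
  simp only [twoDivisionUCubic, map_add, map_mul, map_pow, aeval_X, aeval_C, eq_ratCast] at h
  rw [← ratCast_b₂_integralModelInt, ← ratCast_b₄_integralModelInt, ← ratCast_b₆_integralModelInt] at h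
  push_cast at h
  -- `y³ = -(A + B + C)`
  set A : ℚ_[2] := (M.b₂ : ℚ_[2]) * y ^ 2 with hA
  set B : ℚ_[2] := ((8 * M.b₄ : ℤ) : ℚ_[2]) * y with hB
  set Cc : ℚ_[2] := ((16 * M.b₆ : ℤ) : ℚ_[2]) with hC
  have hcube : y ^ 3 = -(A + B + Cc) := by
    rw [hA, hB, hC]; push_cast; linear_combination h
  have hNcube : ‖y‖ ^ 3 = ‖A + B + Cc‖ := by rw [← norm_pow, hcube, norm_neg]
  have hN0 : 0 ≤ ‖y‖ := norm_nonneg y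
  have hnA : ‖A‖ ≤ (1 / 2 : ℝ) ^ 2 * ‖y‖ ^ 2 := by
    rw [hA, norm_mul, norm_pow]
    exact mul_le_mul_of_nonneg_right hnb₂ (pow_nonneg hN0 2)
  have hnB : ‖B‖ ≤ (1 / 2 : ℝ) ^ 4 * ‖y‖ := by
    rw [hB, norm_mul]
    exact mul_le_mul_of_nonneg_right hnb₄ hN0
  have hnC : ‖Cc‖ = (1 / 2 : ℝ) ^ 4 := by rw [hC]; exact hnb₆
  have hABC : ‖A + B + Cc‖ ≤ max (max ‖A‖ ‖B‖) ‖Cc‖ :=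
    (Padic.nonarchimedean _ _).trans (max_le_max (Padic.nonarchimedean _ _) le_rfl)
  by_cases hbig : (1 / 2 : ℝ) ≤ ‖y‖
  · -- every term is `< ‖y‖³`
    have h3 : (1 / 2 : ℝ) ^ 3 ≤ ‖y‖ ^ 3 := pow_le_pow_left₀ (by norm_num) hbig 3
    have hltA : ‖A‖ < ‖y‖ ^ 3 := hnA.trans_lt (by nlinarith)
    have hltB : ‖B‖ < ‖y‖ ^ 3 := hnB.trans_lt (by nlinarith)
    have hltC : ‖Cc‖ < ‖y‖ ^ 3 := by rw [hnC]; nlinarith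
    have : max (max ‖A‖ ‖B‖) ‖Cc‖ < ‖y‖ ^ 3 := max_lt (max_lt hltA hltB) hltC
    exact absurd (hNcube ▸ hABC) (not_le.mpr this)
  · -- `‖y‖ ≤ 1/4`: the constant term dominates, `‖y‖³ = 1/16`, impossible
    -- discreteness of `‖·‖` on `ℚ₂`: `‖y‖ < 2⁻¹ ⟹ ‖y‖ ≤ 2⁻²`
    have hsmall : ‖y‖ ≤ 1 / 4 := by
      have := (Padic.norm_le_pow_iff_norm_lt_pow_add_one y (-2)).mpr (by norm_num; exact not_le.mp hbig)
      norm_num at this; exact this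
    have hAB : ‖A + B‖ < ‖Cc‖ := by
      refine (Padic.nonarchimedean A B).trans_lt (max_lt ?_ ?_)
      · rw [hnC]; exact hnA.trans_lt (by nlinarith)
      · rw [hnC]; exact hnB.trans_lt (by nlinarith)
    have hsum : ‖A + B + Cc‖ = ‖Cc‖ := by
      rw [Padic.add_eq_max_of_ne hAB.ne, max_eq_right hAB.le]
    rw [hsum, hnC] at hNcube
    have : ‖y‖ ^ 3 ≤ (1 / 4 : ℝ) ^ 3 := pow_le_pow_left₀ hN0 hsmall 3
    rw [hNcube] at this
    norm_num at this

/-! ## §3 The dictionary on the good-at-`2` locus: ordinary ⟺ a `ℚ₂`-root ⟺ the cubic `2`-division field is dyadic -/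

/-- **Good reduction at `2`: ORDINARY ⟺ the `u`-cubic has a root in `ℚ₂`.**  (⟹ is the tree's Hensel root
`…KilfordStratum.exists_padicInt_root_of_isOrdinaryAt_two`; ⟸ is §2.) [cite: SilvermanAEC2009, V.4, VII.2] [cite: Serre1972, §1.11] -/
theorem isOrdinaryAt_two_iff_exists_padic_root (W : WeierstrassCurve ℚ) [W.IsElliptic] [W.IsGloballyMinimal]
    (hgood : W.HasGoodReductionAtPrime 2) :
    IsOrdinaryAt W 2 ↔ ∃ y : ℚ_[2], aeval y (twoDivisionUCubic W) = 0 := by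
  constructor
  · intro hord
    obtain ⟨e, -, he⟩ := exists_padicInt_root_of_isOrdinaryAt_two W hord
    exact ⟨e, he⟩
  · rintro ⟨y, hy⟩
    refine ⟨hgood, fun hss ↦ ?_⟩
    exact aeval_twoDivisionUCubic_ne_zero_of_two_dvd_frobeniusTrace_two W hgood (by exact_mod_cast hss) y hy

/-- **Good reduction at `2`, `E(ℚ)[2] = 0`, `F` a cubic field with a root `e₁` of the `u`-cubic: ORDINARY ⟺ `F` embeds in `ℚ₂`**
(`ℚ`-algebra maps).  ⟹: a `ℚ₂`-root `y` of `c_W = minpoly e₁` gives `F = ℚ(e₁) → ℚ₂`, `e₁ ↦ y` (power basis); ⟸: `σ(e₁)` is a `ℚ₂`-root.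
[cite: NeukirchANT1999, II §8 (8.2)–(8.3)] [cite: Serre1972, §1.11] -/
theorem isOrdinaryAt_two_iff_nonempty_algHom_padic (W : WeierstrassCurve ℚ) [W.IsElliptic] [W.IsGloballyMinimal]
    (hgood : W.HasGoodReductionAtPrime 2) (ht : ∀ x : ℚ, ¬ HasRationalTwoTorsionX W x)
    {F : Type} [Field F] [NumberField F] (hF : Module.finrank ℚ F = 3) {e₁ : F} (he₁ : aeval e₁ (twoDivisionUCubic W) = 0) :
    IsOrdinaryAt W 2 ↔ Nonempty (F →ₐ[ℚ] ℚ_[2]) := by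
  rw [isOrdinaryAt_two_iff_exists_padic_root W hgood]
  constructor
  · rintro ⟨y, hy⟩
    have hmin : minpoly ℚ e₁ = twoDivisionUCubic W := minpoly_eq_twoDivisionUCubic W ht he₁
    obtain ⟨pb, hgen, -⟩ := exists_powerBasis_gen_eq (natDegree_twoDivisionUCubic W) hF hmin
    have hroot : aeval y (minpoly ℚ pb.gen) = 0 := by rw [hgen, hmin]; exact hy
    exact ⟨pb.lift y hroot⟩
  · rintro ⟨σ⟩
    exact ⟨σ e₁, by rw [aeval_algHom_apply, he₁, map_zero]⟩

/-- The same with bare ring homomorphisms (`F → ℚ₂` is automatically `ℚ`-linear): **ORDINARY ⟺ `Nonempty (F →+* ℚ_[2])`** («`F` is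
dyadic»: a prime of `F` above `2` with `e = f = 1`). [cite: NeukirchANT1999, II §8 (8.2)–(8.3)] [cite: Serre1972, §1.11] -/
theorem isOrdinaryAt_two_iff_nonempty_ringHom_padic (W : WeierstrassCurve ℚ) [W.IsElliptic] [W.IsGloballyMinimal]
    (hgood : W.HasGoodReductionAtPrime 2) (ht : ∀ x : ℚ, ¬ HasRationalTwoTorsionX W x)
    {F : Type} [Field F] [NumberField F] (hF : Module.finrank ℚ F = 3) {e₁ : F} (he₁ : aeval e₁ (twoDivisionUCubic W) = 0) :
    IsOrdinaryAt W 2 ↔ Nonempty (F →+* ℚ_[2]) := by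
  rw [isOrdinaryAt_two_iff_nonempty_algHom_padic W hgood ht hF he₁]
  exact ⟨fun ⟨σ⟩ ↦ ⟨σ.toRingHom⟩, fun ⟨φ⟩ ↦ ⟨φ.toRatAlgHom⟩⟩

/-- `E(ℚ)[2] = 0` in the GK2 dialect (`2 • P = 0 → P = 0`) ⟹ no rational `2`-torsion abscissa (Greenberg's predicate). [cite: SilvermanAEC2009, III.2.3] -/
theorem forall_not_hasRationalTwoTorsionX_of_forall_two_nsmul (W : WeierstrassCurve ℚ) [W.IsElliptic]
    (hT : ∀ P : W.toAffine.Point, 2 • P = 0 → P = 0) : ∀ x : ℚ, ¬ HasRationalTwoTorsionX W x := by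
  intro x hx
  obtain ⟨P, hP0, h2P⟩ := (exists_two_torsion_iff_exists_hasRationalTwoTorsionX' W).mpr ⟨x, hx⟩
  exact hP0 (hT P h2P)

/-- A root `θ` of the `x`-cubic `4x³ + b₂x² + 2b₄x + b₆` (`twoTorsionPolynomial`) gives the root `4θ` of the `u`-cubic. [cite: SilvermanAEC2009, III.2.3] -/
theorem aeval_four_mul_twoDivisionUCubic_eq_zero_of_twoTorsionPolynomial (W : WeierstrassCurve ℚ)
    {F : Type*} [Field F] [CharZero F] [Algebra ℚ F] {θ : F} (hθ : aeval θ W.twoTorsionPolynomial.toPoly = 0) :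
    aeval (4 * θ) (twoDivisionUCubic W) = 0 := by
  rw [aeval_twoDivisionUCubic_four_mul_eq_zero_iff]
  have h := hθ
  simp only [twoTorsionPolynomial, Cubic.toPoly, map_add, map_mul, aeval_C, aeval_X_pow, aeval_X, eq_ratCast] at h
  push_cast at h
  linear_combination h

/-- **The dictionary in Zhai's dialect.**  `W/ℚ` globally minimal, good at `2`, `E(ℚ)[2] = 0`; `F` a cubic `2`-division field of `W`
(`Zhai2016.IsTwoDivisionField W F`: `[F:ℚ] = 3`, `F ∋ θ` with `4θ³ + b₂θ² + 2b₄θ + b₆ = 0`).  Then **`W` is good ORDINARY at `2` iff `F` is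
dyadic** (`Nonempty (F →+* ℚ_[2])`); equivalently `2 ∣ a₂(W)` iff `F` has no degree-one unramified prime above `2`.
[cite: Zhai2016, §1 (the field F)] [cite: Serre1972, §1.11] [cite: NeukirchANT1999, II §8 (8.2)–(8.3)] -/
theorem isOrdinaryAt_two_iff_nonempty_ringHom_padic_of_isTwoDivisionField (W : WeierstrassCurve ℚ) [W.IsElliptic]
    [W.IsGloballyMinimal] (hgood : W.HasGoodReductionAtPrime 2) (hT : ∀ P : W.toAffine.Point, 2 • P = 0 → P = 0)
    {F : Type} [Field F] [NumberField F] (hF : IsTwoDivisionField W F) :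
    IsOrdinaryAt W 2 ↔ Nonempty (F →+* ℚ_[2]) := by
  obtain ⟨hdeg, θ, hθ⟩ := hF
  exact isOrdinaryAt_two_iff_nonempty_ringHom_padic W hgood (forall_not_hasRationalTwoTorsionX_of_forall_two_nsmul W hT) hdeg
    (aeval_four_mul_twoDivisionUCubic_eq_zero_of_twoTorsionPolynomial W hθ)

/-- **Good SUPERSINGULAR reduction at `2` ⟹ no cubic `2`-division field of `W` embeds in `ℚ₂`** (no hypothesis on `E(ℚ)[2]`: any ring map
`F → ℚ₂` carries `θ` to a `ℚ₂`-root of the `x`-cubic, i.e. `4θ` to a root of `c_W`, excluded by §2).  So on the card's good-at-`2` cell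
«`F` dyadic» and «`a₂(W)` odd» say the same thing, and «`2 ∣ a₂(W)`» excludes every dyadic `F`.
[cite: Serre1972, §1.11] [cite: Zhai2016, §1 (the field F)] -/
theorem isEmpty_ringHom_padic_of_two_dvd_frobeniusTrace_two (W : WeierstrassCurve ℚ) [W.IsElliptic] [W.IsGloballyMinimal]
    (hgood : W.HasGoodReductionAtPrime 2) (hss : (2 : ℤ) ∣ W.frobeniusTrace 2)
    {F : Type} [Field F] [NumberField F] (hF : IsTwoDivisionField W F) : IsEmpty (F →+* ℚ_[2]) := by
  obtain ⟨-, θ, hθ⟩ := hF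
  refine ⟨fun φ ↦ ?_⟩
  have h4 := aeval_four_mul_twoDivisionUCubic_eq_zero_of_twoTorsionPolynomial W hθ
  have hroot : aeval (φ.toRatAlgHom (4 * θ)) (twoDivisionUCubic W) = 0 := by
    rw [aeval_algHom_apply, h4, map_zero]
  exact aeval_twoDivisionUCubic_ne_zero_of_two_dvd_frobeniusTrace_two W hgood hss _ hroot

end Summit.BirchSwinnertonDyer.BirchSwinnertonDyer.Theorems.GenusExact.TwinSwap.DyadicOrdinary

end
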